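import Mathlib
import HarnessLib
import Summits.HubbardSuperconductivity.HubbardSuperconductivity.Theorems.KLProgrammeKLRegimeTwoVolumeTowerTruncSpineStepS
import Summits.HubbardSuperconductivity.HubbardSuperconductivity.Theorems.KLProgrammeKLRegimeTwoVolumeDefectSupSpine

/-!
# Route `KLProgramme` — crux K3, VL child `KLRegimeVolumeLimitV17F2` (stmt-HubbardSuperconductivity-20440), blueprint v5 M5 / W5-TS: THE LIMIT SPINE ON THE
# SOURCE-RESCALED TRUNCATED TOWER (located «SRC-DEG2», cure (β) of plan g22 (R171); seat hubbard-kl-k3c4-p1 g15; `--supports` 20440)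

Twin of `…TwoVolumeTowerTruncSpine.towerTrunc_keyedDefect_eventually_le` (p618843) for the rescaled truncated keyed defects `klKeyedDefectTS … t j` and the
rescaled bundles `TowerVolumeDataTS … t` (`…TowerSrcScaledDefs`): given the data eventually in `L`, the volume-free constants with their smallness, the mismatch
rates and the BASE (step `0`), the keyed defect of the rescaled truncated states at the `2(j+1) r_L`-deep pins tends to zero uniformly in the admissible
instance, at every step `j ≤ J` and in every degree (Tannery bookkeeping per scale, the step being `…TowerTruncSpineStepS.towerTruncS_keyedDefect_succ_le`).

* **`towerTruncS_keyedDefect_eventually_le`**.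

Proofs only; no definition.
-/

noncomputable section

namespace Summit.HubbardSuperconductivity.HubbardSuperconductivity.Theorems.TwoVolumeSource

set_option linter.dupNamespace false -- summit = problem name (single-conjunct summit), D-0017

open Finset Filter Topology Literature.MathematicalPhysics.QuantumLattice GrassmannAlgebra Literature.Probability.LatticeModels
  Literature.Probability.LatticeModels.BattleFederbush
open Summit.HubbardSuperconductivity.HubbardSuperconductivity.Theorems.TwoPointAssembly
open Summit.HubbardSuperconductivity.HubbardSuperconductivity.Theorems.KLRegimeSplit
open Summit.HubbardSuperconductivity.HubbardSuperconductivity.Theorems.KLProgrammeLegKernels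
open Summit.HubbardSuperconductivity.HubbardSuperconductivity.Theorems.EngineV8
open Summit.HubbardSuperconductivity.HubbardSuperconductivity.Theorems.TwoVolumeDefect

set_option maxHeartbeats 400000 in -- the spine's twenty data functions and their twenty-five obligations in one declaration
/-- **THE LIMIT SPINE ON THE SOURCE-RESCALED TRUNCATED TOWER** (see the module docstring). [folklore: Tannery's theorem per scale; cite: BenfattoGiulianiMastropietro2006, §2.7-§2.9
and §3] -/
theorem towerTruncS_keyedDefect_eventually_le (β U μ : ℝ) (hβ : β ≠ 0) (Kfr : ℕ → ℕ → TrigPolyC4v) (t : ℝ) (J : ℕ) (Adm : ℕ → ℕ → ℕ → Prop) (ε : ℕ → ℝ)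
    (hε : ∀ L b M, Adm L b M → 0 < ε M) (r : ℕ → ℕ) (hr : Tendsto r atTop atTop)
    -- volume-free constants per scale, E1's L-free even budgets `NV`, the raw budgets `NS` of the states
    (Λ κ aW sW κ' aW' sW' eW' ΛT cW κf cRb cCb δb ρ₀ ρf ρ₂ ρ' ρ₃ ν₀ ν₁ ν₂ ν₃ ν₄ ν₅ νE ν₆ ν₇ ν₈ : ℕ → ℝ) (NV NS : ℕ → ℕ → ℝ)
    (hΛ : ∀ j, 0 < Λ j) (hΛmono : ∀ j, Λ (j + 1) ≤ Λ j) (hΛT : ∀ j, Λ j ≤ ΛT j)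
    (hκ : ∀ j, 0 < κ j ∧ 0 < κ' j ∧ 0 < κf j) (haW : ∀ j, 0 ≤ aW j ∧ 0 ≤ aW' j ∧ 0 ≤ sW j ∧ 0 ≤ sW' j ∧ 0 ≤ eW' j ∧ 0 ≤ cW j ∧ 0 ≤ δb j)
    (hρ : ∀ j, 0 < ρ₀ j ∧ 0 < ρf j ∧ 0 < ρ₂ j ∧ 0 < ρ' j ∧ 0 < ρ₃ j) (hNV0 : ∀ j m, 0 ≤ NV j m) (hNSnn : ∀ j k, 0 ≤ NS j k)
    (hNS0 : ∀ k, NS 0 k = if Even k then NV 0 (k / 2) else 0)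
    (hNSsucc : ∀ j k, j < J → NS (j + 1) k = (ρ₀ j)⁻¹ ^ k * (Real.exp 1 * ν₀ j) / (1 - Real.exp 1 * aW j * ν₀ j / κ j ^ 2))
    (hsm : ∀ j, j < J → TowerScaleSmall (κ j) (κ' j) (aW j) (aW' j) (cW j) (κf j) (cRb j) (cCb j) (δb j) (ρ₀ j) (ρf j) (ρ₂ j) (ρ' j) (ρ₃ j) (NV j) (NS j)
      (ν₀ j) (ν₁ j) (ν₂ j) (ν₃ j) (ν₄ j) (ν₅ j) (νE j) (ν₆ j) (ν₇ j) (ν₈ j))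
    -- the mismatch rates of the fine volume's own frame against the coarse frame: signs, caps, limits
    (sE cR cC δ : ℕ → ℕ → ℝ)
    (hmis : ∀ j L, 0 ≤ sE j L ∧ 0 ≤ cR j L ∧ 0 ≤ cC j L ∧ 0 ≤ δ j L ∧ cR j L ≤ cRb j ∧ cC j L ≤ cCb j ∧ δ j L ≤ δb j)
    (hmis0 : ∀ j, Tendsto (sE j) atTop (𝓝 0) ∧ Tendsto (cR j) atTop (𝓝 0) ∧ Tendsto (cC j) atTop (𝓝 0) ∧ Tendsto (δ j) atTop (𝓝 0))
    -- THE DATA: eventually in `L`, at every admissible instance, the three bundles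
    (hdata : ∀ᶠ L in atTop, ∀ (b M : ℕ) [NeZero L] [NeZero (b * L)] [NeZero M], Adm L b M →
      TowerVolumeDataTS L M β U μ (Kfr L M) J (ε M) t Λ κ aW sW NV ∧ TowerVolumeDataTS (b * L) M β U μ (Kfr (b * L) M) J (ε M) t Λ κ aW sW NV ∧
        TowerCrossData L b M β μ (Kfr L M) (Kfr (b * L) M) J (ε M) Λ κ' aW' sW' eW' ΛT cW κf
          (fun j => sE j L) (fun j => cR j L) (fun j => cC j L) (fun j => δ j L))
    -- THE BASE: the keyed defect of the states of step `0` at the `2 r_L`-deep pins tends to zero uniformly in the instance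
    (h0 : ∀ (k : ℕ) (η : ℝ), 0 < η → ∀ᶠ L in atTop, ∀ (b M : ℕ) [NeZero L] [NeZero (b * L)] [NeZero M], Adm L b M →
      ∀ (p : Fin k) (w : SrcLabel (b * L) M 0), (∀ i, 2 * r L ≤ (w.1.1.2 i).val % L ∧ (w.1.1.2 i).val % L + 2 * r L < L) →
        klKeyedDefectTS L b M β U μ (Kfr L M) (Kfr (b * L) M) t 0 k p w ≤ ε M * η) :
    ∀ j, j ≤ J → ∀ (k : ℕ) (η : ℝ), 0 < η → ∀ᶠ L in atTop, ∀ (b M : ℕ) [NeZero L] [NeZero (b * L)] [NeZero M], Adm L b M →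
      ∀ (p : Fin k) (w : SrcLabel (b * L) M (j - 1)), (∀ i, 2 * (j + 1) * r L ≤ (w.1.1.2 i).val % L ∧ (w.1.1.2 i).val % L + 2 * (j + 1) * r L < L) →
        klKeyedDefectTS L b M β U μ (Kfr L M) (Kfr (b * L) M) t j k p w ≤ ε M * η := by
  classical
  -- §0 signs and elementary facts
  have he0 : 0 ≤ Real.exp 1 := (Real.exp_pos 1).le
  have hΛT0 : ∀ j, 0 < ΛT j := fun j => (hΛ j).trans_le (hΛT j)
  have hΛm : ∀ j, Λ j ≤ Λ (j - 1) := fun j => by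
    cases j with
    | zero => exact le_rfl
    | succ k => exact hΛmono k
  have hRr : ∀ j, Tendsto (fun L => 2 * (j + 1) * r L + r L) atTop atTop := fun j => tendsto_atTop_mono (fun L => Nat.le_add_left _ _) hr
  -- §1 the instances and the normalised defect
  let Inst : ℕ → ℕ → ℕ → Type := fun j k L =>
    Σ' (b : ℕ) (M : ℕ) (_ : NeZero L) (_ : NeZero (b * L)) (_ : NeZero M)
      (_ : Adm L b M ∧ j ≤ J ∧ TowerVolumeDataTS L M β U μ (Kfr L M) J (ε M) t Λ κ aW sW NV ∧
        TowerVolumeDataTS (b * L) M β U μ (Kfr (b * L) M) J (ε M) t Λ κ aW sW NV ∧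
          TowerCrossData L b M β μ (Kfr L M) (Kfr (b * L) M) J (ε M) Λ κ' aW' sW' eW' ΛT cW κf
            (fun j => sE j L) (fun j => cR j L) (fun j => cC j L) (fun j => δ j L))
      (p : Fin k), {w : SrcLabel (b * L) M (j - 1) // ∀ i, 2 * (j + 1) * r L ≤ (w.1.1.2 i).val % L ∧ (w.1.1.2 i).val % L + 2 * (j + 1) * r L < L}
  obtain ⟨D, hD⟩ : ∃ D : (j k L : ℕ) → Inst j k L → ℝ, ∀ (j k L b M : ℕ) (iL : NeZero L) (ibL : NeZero (b * L)) (iM : NeZero M)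
      (h : Adm L b M ∧ j ≤ J ∧ TowerVolumeDataTS L M β U μ (Kfr L M) J (ε M) t Λ κ aW sW NV ∧
        TowerVolumeDataTS (b * L) M β U μ (Kfr (b * L) M) J (ε M) t Λ κ aW sW NV ∧
          TowerCrossData L b M β μ (Kfr L M) (Kfr (b * L) M) J (ε M) Λ κ' aW' sW' eW' ΛT cW κf
            (fun j => sE j L) (fun j => cR j L) (fun j => cC j L) (fun j => δ j L))
      (p : Fin k) (w : {w : SrcLabel (b * L) M (j - 1) // ∀ i, 2 * (j + 1) * r L ≤ (w.1.1.2 i).val % L ∧ (w.1.1.2 i).val % L + 2 * (j + 1) * r L < L}),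
      D j k L ⟨b, M, iL, ibL, iM, h, p, w⟩ = (ε M)⁻¹ * klKeyedDefectTS L b M β U μ (Kfr L M) (Kfr (b * L) M) t j k p w.1 :=
    ⟨fun j k L i => match i with
      | ⟨b, M, _, _, _, _, p, w⟩ => (ε M)⁻¹ * klKeyedDefectTS L b M β U μ (Kfr L M) (Kfr (b * L) M) t j k p w.1, fun _ _ _ _ _ _ _ _ _ _ _ => rfl⟩
  -- the states of both volumes at every admissible instance: parity and raw profiles `ε·NS j`
  have hstate : ∀ {V M : ℕ} [NeZero V] [NeZero M] (K : TrigPolyC4v), 0 < ε M → TowerVolumeDataTS V M β U μ K J (ε M) t Λ κ aW sW NV → ∀ j, j ≤ J →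
      klTowerStateS V M β U μ K t j ∈ evenOdd ℂ 0 ∧ constPart ℂ (klTowerStateS V M β U μ K t j) = 0 ∧
        WtProfileRaw (srcTrunc ℂ (fun q : SrcLabel V M (j - 1) => q.2 = 1) 3 (klTowerStateS V M β U μ K t j)) (Λ (j - 1)) (fun k => ε M * NS j k) :=
    fun K hεM hd j hj => towerStateTS_parity_profile β U μ K t J hεM Λ κ aW sW ρ₀ ν₀ NV NS hd hΛ (fun j => (hρ j).1) hNV0
      (fun j hj => (hsm j hj).hν₀) (fun j hj => (hsm j hj).hθ₀) hNS0 hNSsucc j hj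
  -- §2 the spine's data functions (sources, majorants, coefficients), each with its defining equation
  obtain ⟨a, ha⟩ : ∃ a : ℕ → ℝ, ∀ j, a j = if j < J then cW j else 0 := ⟨_, fun _ => rfl⟩
  have ha0 : ∀ j, 0 ≤ a j := fun j => by rw [ha]; split_ifs; exacts [(haW j).2.2.2.2.2.1, le_rfl]
  obtain ⟨τ, hτ⟩ : ∃ τ : ℕ → ℕ → ℝ, ∀ j L, τ j L = if j < J then cW j / (1 + ΛT j * ((r L : ℝ) + 1)) else 0 := ⟨_, fun _ _ => rfl⟩
  obtain ⟨Nfar, hNfar⟩ : ∃ Nfar : ℕ → ℕ → ℕ → ℝ, ∀ j k L, Nfar j k L = (1 + Λ (j - 1) * ((r L : ℝ) + 1))⁻¹ * NS j k := ⟨_, fun _ _ _ => rfl⟩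
  obtain ⟨φRd, hφRd⟩ : ∃ φRd : ℕ → ℕ → ℝ, ∀ j L, φRd j L = 1 + Λ j * ((r L : ℝ) + 1) := ⟨_, fun _ _ => rfl⟩
  obtain ⟨Rf, hRf⟩ : ∃ Rf : ℕ → ℕ → ℝ, ∀ j L, Rf j L = Λ j * ((r L : ℝ) + 1) := ⟨_, fun _ _ => rfl⟩
  obtain ⟨T, hT⟩ : ∃ T : ℕ → ℕ → ℝ, ∀ j L, T j L = aW' j / (1 + Λ j * (((2 * (j + 1) * r L + r L : ℕ) : ℝ) + 1)) := ⟨_, fun _ _ => rfl⟩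
  obtain ⟨Te, hTe⟩ : ∃ Te : ℕ → ℕ → ℝ, ∀ j L, Te j L =
      eW' j / (1 + Λ j * (((2 * (j + 1) * r L + r L : ℕ) : ℝ) + 1)) + (sE j L + (cR j L + cC j L) + δ j L) := ⟨_, fun _ _ => rfl⟩
  obtain ⟨KE, hKE⟩ : ∃ KE : ℕ → ℕ → ℝ, ∀ j n, KE j n =
      if j < J then (ρ' j)⁻¹ ^ (n + 1) * Real.exp 1 / (1 - Real.exp 1 * aW' j * (ν₁ j + νE j) / κ' j ^ 2) ^ 2 else 0 := ⟨_, fun _ _ => rfl⟩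
  obtain ⟨KD, hKD⟩ : ∃ KD : ℕ → ℕ → ℝ, ∀ j n, KD j n =
      if j < J then (ρ' j)⁻¹ ^ (n + 1) * (Real.exp 1 * ν₂ j) / (1 - Real.exp 1 * aW' j * (ν₃ j + ν₂ j) / κ' j ^ 2) ^ 2 else 0 := ⟨_, fun _ _ => rfl⟩
  obtain ⟨KTe, hKTe⟩ : ∃ KTe : ℕ → ℕ → ℝ, ∀ j n, KTe j n = if j < J then
      (((((n + 1 + 1) * (n + 1 + 2) : ℕ) : ℝ) / 2 *
          ((ρ₂ j)⁻¹ ^ (n + 3) * (Real.exp 1 * ν₄ j) / (1 - Real.exp 1 * (aW' j + aW j + (aW' j + aW j)) * ν₄ j / (κ' j + κ j + (κ' j + κ j + (κ' j + κ j))) ^ 2)))) +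
        (((((n + 1 + 1) * (n + 1 + 2) : ℕ) : ℝ) / 2 * ((ρ₃ j)⁻¹ ^ (n + 3) * (Real.exp 1 * ν₆ j) / (1 - Real.exp 1 * (aW' j + (cRb j + cCb j)) * ν₆ j / κf j ^ 2))) +
         (‖(2 : ℂ)⁻¹‖ * ∑ a' ∈ range (n + 2), ∑ b' ∈ range (n + 2),
        (if a' + b' = n + 1 then (((a' + 1) * (b' + 1) : ℕ) : ℝ) *
          (((ρ₃ j)⁻¹ ^ (a' + 1) * (Real.exp 1 * ν₆ j) / (1 - Real.exp 1 * (aW' j + (cRb j + cCb j)) * ν₆ j / κf j ^ 2)) *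
            ((ρ₃ j)⁻¹ ^ (b' + 1) * (Real.exp 1 * ν₆ j) / (1 - Real.exp 1 * (aW' j + (cRb j + cCb j)) * ν₆ j / κf j ^ 2))) else 0)) +
         ((ρ₃ j)⁻¹ ^ (n + 1) * (Real.exp 1 * ν₈ j) / (1 - Real.exp 1 * aW' j * (ν₇ j + δb j * ν₈ j) / κf j ^ 2) ^ 2)) else 0 := ⟨_, fun _ _ => rfl⟩
  obtain ⟨KT, hKT⟩ : ∃ KT : ℕ → ℕ → ℝ, ∀ j n, KT j n = if j < J then
      (‖(2 : ℂ)⁻¹‖ * ∑ a ∈ range (n + 2), ∑ b ∈ range (n + 2),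
          (if a + b = n + 1 then (((a + 1) * (b + 1) : ℕ) : ℝ) *
            (4 * ((ρ₂ j)⁻¹ ^ (a + 1) * (Real.exp 1 * ν₄ j) / (1 - Real.exp 1 * (aW' j + aW j + (aW' j + aW j)) * ν₄ j / (κ' j + κ j + (κ' j + κ j + (κ' j + κ j))) ^ 2)) *
              ((ρ₂ j)⁻¹ ^ (b + 1) * (Real.exp 1 * ν₄ j) / (1 - Real.exp 1 * (aW' j + aW j + (aW' j + aW j)) * ν₄ j / (κ' j + κ j + (κ' j + κ j + (κ' j + κ j))) ^ 2))) else 0))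
      else 0 := ⟨_, fun _ _ => rfl⟩
  obtain ⟨KRf, hKRf⟩ : ∃ KRf : ℕ → ℕ → ℝ, ∀ j n, KRf j n = if j < J then
      (((((n + 1 + 1) * (n + 1 + 2) : ℕ) : ℝ) / 2 * (sW' j + sW j) *
            ((ρf j)⁻¹ ^ (n + 3) * (Real.exp 1 * ν₅ j) / (1 - Real.exp 1 * (aW' j + aW j + (aW' j + aW j)) * ν₅ j / (κ' j + κ j) ^ 2)) +
          ‖(2 : ℂ)⁻¹‖ * ∑ a ∈ range (n + 2), ∑ b ∈ range (n + 2),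
            (if a + b = n + 1 then (((a + 1) * (b + 1) : ℕ) : ℝ) *
              (2 * (aW' j + aW j) * ((ρf j)⁻¹ ^ (a + 1) * (Real.exp 1 * ν₅ j) / (1 - Real.exp 1 * (aW' j + aW j + (aW' j + aW j)) * ν₅ j / (κ' j + κ j) ^ 2)) *
                ((ρf j)⁻¹ ^ (b + 1) * (Real.exp 1 * ν₅ j) / (1 - Real.exp 1 * (aW' j + aW j + (aW' j + aW j)) * ν₅ j / (κ' j + κ j) ^ 2))) else 0)))
      else 0 := ⟨_, fun _ _ => rfl⟩
  -- §3 signs of the coefficients (from the smallness of the scales `j < J`; zero beyond)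
  have hνnn : ∀ j, j < J → 0 ≤ ν₀ j ∧ 0 ≤ ν₂ j ∧ 0 ≤ ν₄ j ∧ 0 ≤ ν₅ j ∧ 0 ≤ ν₆ j ∧ 0 ≤ ν₈ j := by
    intro j hj
    have hs := hsm j hj
    obtain ⟨hκj, hκ'j, hκfj⟩ := hκ j
    obtain ⟨hρ₀, hρf, hρ₂, hρ', hρ₃⟩ := hρ j
    obtain ⟨haWj, haW'j, -, -, -, hcWj, hδbj⟩ := haW j
    have hν₀ : 0 ≤ ν₀ j := hs.hν₀.nonneg_of_nonneg fun m => mul_nonneg (normVWeight_nonneg _ _ hκj.le hρ₀.le m) (hNV0 j m)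
    have hθ₀' : 0 < 1 - Real.exp 1 * aW j * ν₀ j / κ j ^ 2 := sub_pos.2 hs.hθ₀
    have hNw : ∀ m, 0 ≤ (ρ₀ j)⁻¹ ^ (2 * m) * (Real.exp 1 * ν₀ j) / (1 - Real.exp 1 * aW j * ν₀ j / κ j ^ 2) := fun m => by positivity
    have hNW : ∀ m, 0 ≤ cW j ^ (2 * m - 1) * (cW j * NS j (2 * m)) := fun m => mul_nonneg (pow_nonneg hcWj _) (mul_nonneg hcWj (hNSnn j _))
    have hcδ : 0 ≤ cW j + δb j := add_nonneg hcWj hδbj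
    refine ⟨hν₀, hs.hν₂.nonneg_of_nonneg fun m => mul_nonneg (normVWeight_nonneg _ _ hκ'j.le hρ'.le m) (add_nonneg (hNW m) (hNV0 j m)),
      hs.hν₄.nonneg_of_nonneg fun m => mul_nonneg (normVWeight_nonneg _ _ (by positivity) hρ₂.le m) (hNw m),
      hs.hν₅.nonneg_of_nonneg fun m => mul_nonneg (normVWeight_nonneg _ _ (by positivity) hρf.le m) (hNw m),
      hs.hν₆.nonneg_of_nonneg fun m => mul_nonneg (normVWeight_nonneg _ _ hκfj.le hρ₃.le m)
        (add_nonneg (hNW m) (mul_nonneg (mul_nonneg (mul_nonneg (by positivity) (pow_nonneg hcδ _)) hδbj) (hNSnn j _))),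
      hs.hν₈.nonneg_of_nonneg fun m => mul_nonneg (normVWeight_nonneg _ _ hκfj.le hρ₃.le m)
        (mul_nonneg (mul_nonneg (by positivity) (pow_nonneg hcδ _)) (hNSnn j _))⟩
  have hK0 : ∀ j n, 0 ≤ KE j n ∧ 0 ≤ KD j n ∧ 0 ≤ KTe j n ∧ 0 ≤ KT j n ∧ 0 ≤ KRf j n := by
    intro j n
    rw [hKE, hKD, hKTe, hKT, hKRf]
    by_cases hj : j < J
    · simp only [if_pos hj]
      have hs := hsm j hj
      obtain ⟨hν₀, hν₂, hν₄, hν₅, hν₆, hν₈⟩ := hνnn j hj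
      obtain ⟨hρ₀, hρf, hρ₂, hρ', hρ₃⟩ := hρ j
      obtain ⟨haWj, haW'j, hsWj, hsW'j, -, hcWj, hδbj⟩ := haW j
      have h2 : 0 < 1 - Real.exp 1 * (aW' j + aW j + (aW' j + aW j)) * ν₄ j / (κ' j + κ j + (κ' j + κ j + (κ' j + κ j))) ^ 2 := sub_pos.2 hs.hθ₂
      have hw : 0 < 1 - Real.exp 1 * (aW' j + aW j + (aW' j + aW j)) * ν₅ j / (κ' j + κ j) ^ 2 := sub_pos.2 hs.hθw
      have hf1 : 0 < 1 - Real.exp 1 * (aW' j + (cRb j + cCb j)) * ν₆ j / κf j ^ 2 := sub_pos.2 hs.hθf₁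
      have hG₄ : ∀ k : ℕ, 0 ≤ (ρ₂ j)⁻¹ ^ k * (Real.exp 1 * ν₄ j) /
          (1 - Real.exp 1 * (aW' j + aW j + (aW' j + aW j)) * ν₄ j / (κ' j + κ j + (κ' j + κ j + (κ' j + κ j))) ^ 2) := fun k => div_nonneg (by positivity) h2.le
      have hG₆ : ∀ k : ℕ, 0 ≤ (ρ₃ j)⁻¹ ^ k * (Real.exp 1 * ν₆ j) / (1 - Real.exp 1 * (aW' j + (cRb j + cCb j)) * ν₆ j / κf j ^ 2) :=
        fun k => div_nonneg (by positivity) hf1.le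
      have hGf : ∀ k : ℕ, 0 ≤ (ρf j)⁻¹ ^ k * (Real.exp 1 * ν₅ j) / (1 - Real.exp 1 * (aW' j + aW j + (aW' j + aW j)) * ν₅ j / (κ' j + κ j) ^ 2) :=
        fun k => div_nonneg (by positivity) hw.le
      refine ⟨div_nonneg (by positivity) (sq_nonneg _), div_nonneg (by positivity) (sq_nonneg _), ?_, ?_, ?_⟩
      · refine add_nonneg (mul_nonneg (by positivity) (hG₄ _)) (add_nonneg (add_nonneg (mul_nonneg (by positivity) (hG₆ _))
          (mul_nonneg (norm_nonneg _) (sum_nonneg fun a' _ => sum_nonneg fun b' _ => ?_))) (div_nonneg (by positivity) (sq_nonneg _)))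
        split_ifs
        · exact mul_nonneg (by positivity) (mul_nonneg (hG₆ _) (hG₆ _))
        · exact le_rfl
      · refine mul_nonneg (norm_nonneg _) (sum_nonneg fun a _ => sum_nonneg fun b _ => ?_)
        split_ifs
        · exact mul_nonneg (by positivity) (mul_nonneg (mul_nonneg (by norm_num) (hG₄ _)) (hG₄ _))
        · exact le_rfl
      · refine add_nonneg (mul_nonneg (mul_nonneg (by positivity) (add_nonneg hsW'j hsWj)) (hGf _))
          (mul_nonneg (norm_nonneg _) (sum_nonneg fun a _ => sum_nonneg fun b _ => ?_))
        split_ifs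
        · exact mul_nonneg (by positivity) (mul_nonneg (mul_nonneg (by positivity) (hGf _)) (hGf _))
        · exact le_rfl
    · simp only [if_neg hj]; exact ⟨le_rfl, le_rfl, le_rfl, le_rfl, le_rfl⟩
  -- §4 the spine
  have hsp := defectSup_eventually_le_of_bdd_dep J Inst D (fun j k => NS j k + NS j k) NS (fun j k => NS j k + NS j k) a a NS
    τ Te T φRd Rf Nfar KE KD KTe KT KRf κ' ρ'
    (fun j => (hκ j).2.1.le) (fun j => (hρ j).2.2.2.1.le) ha0 (fun j k => hNSnn j k)
    (fun j k => add_nonneg (hNSnn j k) (hNSnn j k)) ?hDnn (fun j k => add_nonneg (hNSnn j k) (hNSnn j k)) ?hDbd ?hτnn ?hτbd ?hτlim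
    ?hNfnn ?hNfbd ?hNflim ?hTelim ?hTlim ?hφ ?hRfl hK0 ?hsrc0 ?hsum ?h0 ?hdeg0 ?hrec
  -- §5 read the conclusion at the admissible instances
  · intro j hj k η hη
    filter_upwards [hsp j hj k η hη, hdata] with L hL hdat
    intro b M iL ibL iM hA p w hw
    obtain ⟨hdL, hdF, hX⟩ := hdat b M hA
    have h := hL ⟨b, M, iL, ibL, iM, ⟨hA, hj, hdL, hdF, hX⟩, p, ⟨w, hw⟩⟩
    rw [hD] at h
    exact (inv_mul_le_iff₀ (hε L b M hA)).1 h
  -- §6 the obligations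
  case hDnn =>
    intro j k L i
    obtain ⟨b, M, iL, ibL, iM, ⟨hA, -⟩, p, w⟩ := i
    rw [hD]
    exact mul_nonneg (inv_nonneg.2 (hε L b M hA).le) (klKeyedDefectTS_nonneg β U μ _ _ t j k p w.1)
  case hDbd =>
    intro j k L i
    obtain ⟨b, M, iL, ibL, iM, ⟨hA, hjJ, hdL, hdF, hX⟩, p, w⟩ := i
    rw [hD]
    have hεM := hε L b M hA
    have h := klKeyedDefectTS_le_of_wtProfileRaw β U μ (Kfr L M) (Kfr (b * L) M) t j (hstate (Kfr (b * L) M) hεM hdF j hjJ).2.2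
      (hstate (Kfr L M) hεM hdL j hjJ).2.2 k p w.1
    show _ ≤ NS j k + NS j k
    rw [inv_mul_le_iff₀ hεM]
    exact h.trans (le_of_eq (by ring))
  case hτnn =>
    intro j L; rw [hτ]; have := (haW j).2.2.2.2.2.1; have := (hΛT0 j).le
    split_ifs
    · positivity
    · exact le_rfl
  case hτbd =>
    intro j L; rw [hτ, ha]; have := (hΛT0 j).le
    split_ifs
    · exact div_le_self (haW j).2.2.2.2.2.1 (le_add_of_nonneg_right (by positivity))
    · exact le_rfl
  case hτlim =>
    intro j
    by_cases hj : j < J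
    · have h := tendsto_const_div_one_add_mul_atTop_nat (hΛT0 j) (cW j) hr
      exact h.congr' (Eventually.of_forall fun L => by rw [hτ, if_pos hj])
    · exact tendsto_const_nhds.congr' (Eventually.of_forall fun L => by rw [hτ, if_neg hj])
  case hNfnn =>
    intro j k L; rw [hNfar]; have := (hΛ (j - 1)).le; exact mul_nonneg (inv_nonneg.2 (by positivity)) (hNSnn j k)
  case hNfbd =>
    intro j k L; rw [hNfar]; have := (hΛ (j - 1)).le
    exact (mul_le_mul_of_nonneg_right (inv_le_one_of_one_le₀ (le_add_of_nonneg_right (by positivity))) (hNSnn j k)).trans (le_of_eq (one_mul _))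
  case hNflim =>
    intro j k
    have h := tendsto_inv_one_add_mul_mul_atTop_nat (hΛ (j - 1)) (NS j k) hr
    exact h.congr' (Eventually.of_forall fun L => (hNfar j k L).symm)
  case hTelim =>
    intro j
    obtain ⟨hs, hc, hc', hd⟩ := hmis0 j
    have h1 := tendsto_const_div_one_add_mul_atTop_nat (hΛ j) (eW' j) (hRr j)
    have h := h1.add ((hs.add (hc.add hc')).add hd)
    simp only [add_zero] at h
    exact h.congr' (Eventually.of_forall fun L => (hTe j L).symm)
  case hTlim =>
    intro j
    have h := tendsto_const_div_one_add_mul_atTop_nat (hΛ j) (aW' j) (hRr j)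
    exact h.congr' (Eventually.of_forall fun L => (hT j L).symm)
  case hφ =>
    intro j
    exact (tendsto_one_add_mul_atTop_nat (hΛ j) hr).congr' (Eventually.of_forall fun L => (hφRd j L).symm)
  case hRfl =>
    intro j
    exact (tendsto_mul_add_one_atTop_nat (hΛ j) hr).congr' (Eventually.of_forall fun L => (hRf j L).symm)
  case hsrc0 =>
    intro j L
    obtain ⟨hsE0, hcR0, hcC0, hδ0, -, -, -⟩ := hmis j L
    have := (haW j).2.1; have := (haW j).2.2.2.2.1; have := (hΛ j).le
    rw [hTe, hT, hφRd, hRf]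
    exact ⟨by positivity, by positivity, by positivity, by positivity⟩
  case hsum =>
    intro j
    by_cases hj : j < J
    · -- the dominating series of a step is the `νE` series of its scale
      refine ((hsm j hj).hνE.summable).congr fun m => ?_
      simp only [ha, if_pos hj]
      ring
    · -- beyond the last step the transfer mass is switched off: the series vanishes termwise
      refine summable_zero.congr fun m => ?_
      simp only [ha, if_neg hj]
      ring
  case h0 =>
    intro k η hη
    filter_upwards [h0 k η hη] with L hL i
    obtain ⟨b, M, iL, ibL, iM, ⟨hA, -⟩, p, w⟩ := i
    rw [hD, inv_mul_le_iff₀ (hε L b M hA)]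
    refine hL b M hA p w.1 fun i => ?_
    have h := w.2 i
    constructor <;> omega
  case hdeg0 =>
    intro j η hη
    exact Eventually.of_forall fun L i => by
      obtain ⟨b, M, -, -, -, -, p, -⟩ := i
      exact p.elim0
  case hrec =>
    intro j hj n
    refine Eventually.of_forall fun L Ej hEj0 hEjb hEjD i => ?_
    obtain ⟨b, M, iL, ibL, iM, ⟨hA, hjJ, hdL, hdF, hX⟩, p, w⟩ := i
    have hεM := hε L b M hA
    obtain ⟨hsE0, hcR0, hcC0, hδ0, hcRb, hcCb, hδle⟩ := hmis j L
    obtain ⟨hρ₀, hρf, hρ₂, hρ', hρ₃⟩ := hρ j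
    -- the majorant controls the keyed defects of step `j` at the `2(j+1) r_L`-deep pins
    have hEj : ∀ (k : ℕ) (p' : Fin k) (y' : SrcLabel (b * L) M (j - 1)),
        (∀ i, 2 * (j + 1) * r L ≤ (y'.1.1.2 i).val % L ∧ (y'.1.1.2 i).val % L + 2 * (j + 1) * r L < L) →
          klKeyedDefectTS L b M β U μ (Kfr L M) (Kfr (b * L) M) t j k p' y' ≤ ε M * Ej k := by
      intro k p' y' hy'
      have h := hEjD k ⟨b, M, iL, ibL, iM, ⟨hA, hj.le, hdL, hdF, hX⟩, p', ⟨y', hy'⟩⟩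
      rw [hD] at h
      exact (inv_mul_le_iff₀ hεM).1 h
    have hstep := towerTruncS_keyedDefect_succ_le β U μ hβ (Kfr L M) (Kfr (b * L) M) t J j hj hεM Λ κ aW sW κ' aW' sW' eW' ΛT cW κf
      (fun j => sE j L) (fun j => cR j L) (fun j => cC j L) (fun j => δ j L) NV NS hdL hdF hX (hsm j hj) hΛ (hΛm j) (hΛT j) (hκ j).2.2
      hρ₀ hρf hρ₂ hρ' hρ₃ (haW j).2.2.2.2.2.2 hNV0 (hNSnn j) (hstate (Kfr L M) hεM hdL j hj.le) (hstate (Kfr (b * L) M) hεM hdF j hj.le)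
      hsE0 hcR0 hcC0 hcRb hcCb hδ0 hδle (2 * (j + 1) * r L) (r L) (Nat.mul_le_mul_right (r L) (by omega)) Ej hEj0 hEjb hEj n p w.1
      (fun i => by have h := w.2 i; constructor <;> linarith [h.1, h.2])
    rw [hD, inv_mul_le_iff₀ hεM, hKE, hKD, hKTe, hKT, hKRf, hφRd, hRf, hTe, hT, hτ, ha]
    simp only [if_pos hj, hNfar]
    exact hstep

end Summit.HubbardSuperconductivity.HubbardSuperconductivity.Theorems.TwoVolumeSource

end
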